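/-
Copyright: the b2b-balaban T⁴-continuum CRUX team, row NE7b leaf lineage `t4-ne7b-formalise-leaf-01` (gen 87). Project licence.
-/
import Summits.QuantumFields.BalabanUV.T4Continuum.Spine.NE7b.BlockSectionRowSumKernelData

/-!
# THE SIDE-2 ROW-SUM CERTIFICATE AT FULL KERNEL WEIGHT, FILE 2∕4 — THE BLOCK SUMS AND THE RESIDUE-CLASS SUMS, EVALUATED BY THE KERNEL (`decide +kernel`, thirteen chunks; axioms ⊆ trio)
# (row NE7b, node U5c; block sums `2⁴⁸·δ` on `[−4,4]⁴`, the sixteen residue-class sums `≤ 44770439763378`; the weighted residual sum is file 3∕4;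
# [kernel computation] + [folklore])

Cell `pub-balaban`, sub-cell `t4`, spine estimate NE7b (`T4WeightBudget.RelWeightBound`; the cell's OWN estimate — NOT PRINTED in [Bałaban 1983–89], NOT
PROVED).  Crux-route work under `Spine/NE7b/` by a row leaf (`t4-ne7b-formalise-leaf-01` gen 87) under FREEZE (0)'s crux-prover clause; NOTHING of Bałaban's
is named as a Lean object, valued or asserted; no `T4Continuum/Support` leaf typed; zero `sorry`.  No `def`, no `native_decide`: every computed fact below is a CLOSED
evaluation by the Lean kernel (`decide +kernel` adds an auxiliary lemma checked by `Kernel.isDefEq`; `#print axioms` of each = ⊆ {propext, Classical.choice,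
Quot.sound}).  Import: file 1∕4 `BlockSectionRowSumKernelData` (the data and the recursions).  COST: ≈ 2·10⁵ table reads, ≈ 2–3 minutes of kernel time on
the farm (each chunk under `maxHeartbeats 4000000`, the kernel's deterministic budget; memory per chunk well under the kernel's bound).  ENGINEERING NOTE for
successors: never let the kernel COMPARE two expressions containing these recursions by `rfl` ∕ `dsimp` (lazy delta-reduction then evaluates a slab inside
one definitional-equality check and the memory bound is hit) — assemble by REWRITING with proven equations only (`sum_range6`, the slab values).

WHAT IS HERE: `blockRow_0…8` (block sums `2⁴⁸·δ` on the nine slabs of `[−4,4]⁴`), `classCheck2_00 ∕ 01 ∕ 10 ∕ 11` (the sixteen class sums `≤ 44770439763378`),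
`blockRow_all`, `classCheck2_all` [kernel computation + folklore].

HONEST: [folklore] + kernel computation (axioms ⊆ {propext, Classical.choice, Quot.sound} — no `Lean.ofReduceBool`); the competitor is data, not
Bałaban's object; scalar `U = 1` block-MEAN skeleton on `ℤ⁴`; nothing of (A3) ∕ NC-NE7b-α; BY-NAME EFFECT ON THE WALL: NONE.  NE7b NOT PRINTED ∕ NOT PROVED;
spine PROVED 0∕9; rung (B)+1 on a FINITE torus — NOT infinite volume, NOT the mass gap, NOT Clay.  HONEST DEPENDENCY: continuum YM on T⁴ ⇐ BetaPertH ∧ nine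
spine estimates (0∕9 proved); BetaPertH ⇐ (D1) ∧ (D4) ∧ CAP+tail; G-an2-4 gates asym, D1 and NE2∕3∕4.
-/

set_option autoImplicit false

namespace Summit.QuantumFields.BalabanUV.T4Continuum.NE7b.BlockSectionRowSumKernelSums

open Finset
open Literature.MathematicalPhysics.QuantumFieldTheory.Balaban1983to89
open B6QGQLower276 (X B e blk chart side loc mem_B sum_B blk_chart U mem_U sum_U side_mul_blk_add_loc loc_nonneg loc_le e_apply_self e_apply_ne)
open Summit.QuantumFields.BalabanUV.T4Continuum.NE7b.BlockSectionRowSumValue (rng mem_rng Sbox boxB boxT chart_one_apply)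
open Summit.QuantumFields.BalabanUV.T4Continuum.NE7b.BlockSectionRowSumKernelData

/-! ## §2  The block sums and the residue-class sums — evaluated by the KERNEL in chunks (`decide +kernel`; axioms ⊆ trio) -/

set_option maxHeartbeats 4000000 in
/-- Block sums, slab `b₀ = -4`. [kernel computation] -/
theorem blockRow_0 : blockRow 0 = true := by
  decide +kernel

set_option maxHeartbeats 4000000 in
/-- Block sums, slab `b₀ = -3`. [kernel computation] -/
theorem blockRow_1 : blockRow 1 = true := by
  decide +kernel

set_option maxHeartbeats 4000000 in
/-- Block sums, slab `b₀ = -2`. [kernel computation] -/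
theorem blockRow_2 : blockRow 2 = true := by
  decide +kernel

set_option maxHeartbeats 4000000 in
/-- Block sums, slab `b₀ = -1`. [kernel computation] -/
theorem blockRow_3 : blockRow 3 = true := by
  decide +kernel

set_option maxHeartbeats 4000000 in
/-- Block sums, slab `b₀ = 0`. [kernel computation] -/
theorem blockRow_4 : blockRow 4 = true := by
  decide +kernel

set_option maxHeartbeats 4000000 in
/-- Block sums, slab `b₀ = 1`. [kernel computation] -/
theorem blockRow_5 : blockRow 5 = true := by
  decide +kernel

set_option maxHeartbeats 4000000 in
/-- Block sums, slab `b₀ = 2`. [kernel computation] -/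
theorem blockRow_6 : blockRow 6 = true := by
  decide +kernel

set_option maxHeartbeats 4000000 in
/-- Block sums, slab `b₀ = 3`. [kernel computation] -/
theorem blockRow_7 : blockRow 7 = true := by
  decide +kernel

set_option maxHeartbeats 4000000 in
/-- Block sums, slab `b₀ = 4`. [kernel computation] -/
theorem blockRow_8 : blockRow 8 = true := by
  decide +kernel

set_option maxHeartbeats 4000000 in
/-- Class sums `(0, 0, ·, ·) ≤ 44770439763378`. [kernel computation] -/
theorem classCheck2_00 : classCheck2 0 0 = true := by
  decide +kernel

set_option maxHeartbeats 4000000 in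
/-- Class sums `(0, 1, ·, ·) ≤ 44770439763378`. [kernel computation] -/
theorem classCheck2_01 : classCheck2 0 1 = true := by
  decide +kernel

set_option maxHeartbeats 4000000 in
/-- Class sums `(1, 0, ·, ·) ≤ 44770439763378`. [kernel computation] -/
theorem classCheck2_10 : classCheck2 1 0 = true := by
  decide +kernel

set_option maxHeartbeats 4000000 in
/-- Class sums `(1, 1, ·, ·) ≤ 44770439763378`. [kernel computation] -/
theorem classCheck2_11 : classCheck2 1 1 = true := by
  decide +kernel

/-- All nine block-sum slabs. -/
theorem blockRow_all (i₀ : ℕ) (h : i₀ < 9) : blockRow i₀ = true := by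
  interval_cases i₀
  exacts [blockRow_0, blockRow_1, blockRow_2, blockRow_3, blockRow_4, blockRow_5, blockRow_6, blockRow_7, blockRow_8]

/-- All four class-sum pairs. -/
theorem classCheck2_all (c₀ c₁ : ℕ) (h₀ : c₀ < 2) (h₁ : c₁ < 2) : classCheck2 c₀ c₁ = true := by
  interval_cases c₀ <;> interval_cases c₁
  exacts [classCheck2_00, classCheck2_01, classCheck2_10, classCheck2_11]

end Summit.QuantumFields.BalabanUV.T4Continuum.NE7b.BlockSectionRowSumKernelSums
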